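import Summits.CriticalPhenomena.PercolationContinuityZ3.Theorems.SahiMasterFamilyPrincipalCapBetaSix
import Summits.CriticalPhenomena.PercolationContinuityZ3.Theorems.SahiMasterFamilyPrincipalCapBetaSixCert1
import Summits.CriticalPhenomena.PercolationContinuityZ3.Theorems.SahiMasterFamilyPrincipalCapBetaSixCert2
import Summits.CriticalPhenomena.PercolationContinuityZ3.Theorems.SahiMasterFamilyPrincipalCapBetaSixCert3
import Summits.CriticalPhenomena.PercolationContinuityZ3.Theorems.SahiMasterFamilyPrincipalCapBetaSixCert4
import Summits.CriticalPhenomena.PercolationContinuityZ3.Theorems.SahiMasterFamilyPrincipalCapBetaSixCert5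
import Summits.CriticalPhenomena.PercolationContinuityZ3.Theorems.SahiMasterFamilyPrincipalCapBetaSixCert6
import Summits.CriticalPhenomena.PercolationContinuityZ3.Theorems.SahiMasterFamilyPrincipalCapBetaSixCert7
import Summits.CriticalPhenomena.PercolationContinuityZ3.Theorems.SahiMasterFamilyPrincipalCapBetaSixCert8
import Summits.CriticalPhenomena.PercolationContinuityZ3.Theorems.SahiMasterFamilyPrincipalCapBetaSixCert9
import Summits.CriticalPhenomena.PercolationContinuityZ3.Theorems.SahiMasterFamilyPrincipalCapBetaSixCert10
import Summits.CriticalPhenomena.PercolationContinuityZ3.Theorems.SahiMasterFamilyPrincipalCapBetaSixCert11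
import Summits.CriticalPhenomena.PercolationContinuityZ3.Theorems.SahiMasterFamilyPrincipalCapBetaSixCert12
import Summits.CriticalPhenomena.PercolationContinuityZ3.Theorems.SahiMasterFamilyPrincipalCapBetaSixCert13
import Summits.CriticalPhenomena.PercolationContinuityZ3.Theorems.SahiMasterFamilyPrincipalCapBetaSixCert14
import Summits.CriticalPhenomena.PercolationContinuityZ3.Theorems.SahiMasterFamilyPrincipalCapBetaSixCert15
import Summits.CriticalPhenomena.PercolationContinuityZ3.Theorems.SahiMasterFamilyPrincipalCapBetaSixCert16
import Summits.CriticalPhenomena.PercolationContinuityZ3.Theorems.SahiMasterFamilyPrincipalCapBetaSixCert17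
import Summits.CriticalPhenomena.PercolationContinuityZ3.Theorems.SahiMasterFamilyPrincipalCapBetaSixCert18
import Summits.CriticalPhenomena.PercolationContinuityZ3.Theorems.SahiMasterFamilyPrincipalCapBetaSixCert19
import Summits.CriticalPhenomena.PercolationContinuityZ3.Theorems.SahiMasterFamilyPrincipalCapBetaSixCert20
import Summits.CriticalPhenomena.PercolationContinuityZ3.Theorems.SahiMasterFamilyPrincipalCapBetaSixCert21
import Summits.CriticalPhenomena.PercolationContinuityZ3.Theorems.SahiMasterFamilyPrincipalCapBetaSixCert22

/-!
# `F(6)`: the order-six principal-cap inequality `PhiNonneg 6` is a theorem — hence Sahi's `C₆` on the principal-cap stratum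

Unit `prim-masterthm-p4` (gen 13; crux anchor stmt-CriticalPhenomena-4575, helper work; memo
`run/shared/lean/prim/prim-masterthm/prim-masterthm-p4/P4-GEN13-REPORT.md` §7).

**THEOREM (`phiNonneg_six`).**  `Φ_6(β) ≥ 0` for every set function `β` on `Finset (Fin 6)` with values in `[0,1]`, `β univ = 1` and
`β S · β T ≤ β (S ∪ T)` for all `S, T`.  CERTIFICATE (found by a symmetry-reduced column-generation LP, kit j122110, and verified in exact rational
arithmetic): `Φ_6 = (1/720) Σ_{g ∈ S_6} Σ_{t=1}^{15} c_t · g·(∏ atoms_t)` with `c = (144, 90, 50, 40, 40, 40, 30, 30, 30, 20, 16, 15, 10, 4, 1)`; expanded, 872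
products of the atoms `β_S`, `1 − β_S`, `β_S − β_Aβ_B` (`A ∪ B = S`, OVERLAPPING covers included — necessarily: the variant of `F(6)` with disjoint
covers only is false, memo §6) with positive rational weights; the eleven chunks are `piece1 … piece11` (`…SixCert1–11`), the expansion of `Φ_6` is
`phiSet_six` (`…BetaSix`), and the final step is linear arithmetic over the 877 monomials.
**COROLLARY (`sahiE_six_ind_nonneg_of_principalCap`).**  By the all-orders reduction `PrincipalCapBeta.sahiE_ind_nonneg_of_phiNonneg`: for every
finite product of two-point spaces, every `p`, and every SIX increasing events whose common part is a principal up-set, `E_6(μ_p; 1_U) ≥ 0` —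
Sahi's `C₆` [Sahi2008, Conj. 5] on the principal-cap stratum (orders 3, 4, 5: `…PrincipalCapC3/C4/C5`, `…BetaSmall`).
HONEST FRAMING: `C_6` in general and the master theorem remain OPEN; `F(7)` is open.  Axioms standard. [this work]
-/

noncomputable section

open scoped Classical

namespace Summit.CriticalPhenomena.PercolationContinuityZ3.Theorems

namespace PrincipalCapBeta

open Finset
open Literature.Combinatorics.Sahi2008
open Literature.Probability.Percolation.DecisionTree (ind)

set_option maxRecDepth 200000 in
set_option maxHeartbeats 8000000 in
/-- **`F(6)`**: `Φ_6(β) ≥ 0` for every `[0,1]`-valued, top-normalised, supermultiplicative set function on `Finset (Fin 6)`. [this work] -/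
theorem phiNonneg_six : PhiNonneg 6 := by
  intro β h0 h1 htop hsup
  have hsum := (add_nonneg (piece1_nonneg β h0 h1) (add_nonneg (piece2_nonneg β h0 h1) (add_nonneg (piece3_nonneg β h1 hsup) (add_nonneg (piece4_nonneg β h1 hsup) (add_nonneg (piece5_nonneg β h1 hsup) (add_nonneg (piece6_nonneg β h1 hsup) (add_nonneg (piece7_nonneg β h1) (add_nonneg (piece8_nonneg β h1) (add_nonneg (piece9_nonneg β h1) (add_nonneg (piece10_nonneg β h1) (add_nonneg (piece11_nonneg β h1) (add_nonneg (piece12_nonneg β h1 hsup) (add_nonneg (piece13_nonneg β h1 hsup) (add_nonneg (piece14_nonneg β h1 hsup) (add_nonneg (piece15_nonneg β h1 hsup) (add_nonneg (piece16_nonneg β h1 hsup) (add_nonneg (piece17_nonneg β h1 hsup) (add_nonneg (piece18_nonneg β h1 hsup) (add_nonneg (piece19_nonneg β h1 hsup) (add_nonneg (piece20_nonneg β h1 hsup) (add_nonneg (piece21_nonneg β h1 hsup) (piece22_nonneg β h1 hsup))))))))))))))))))))))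
  rw [piece1_eq β, piece2_eq β, piece3_eq β, piece4_eq β, piece5_eq β, piece6_eq β, piece7_eq β, piece8_eq β, piece9_eq β, piece10_eq β, piece11_eq β, piece12_eq β, piece13_eq β, piece14_eq β, piece15_eq β, piece16_eq β, piece17_eq β, piece18_eq β, piece19_eq β, piece20_eq β, piece21_eq β, piece22_eq β] at hsum
  rw [phiSet_six]
  linarith [hsum, htop]

/-- **Sahi's `C₆` on the principal-cap stratum** (every finite index type, every `p ∈ [0,1]^ι`). [this work] -/
theorem sahiE_six_ind_nonneg_of_principalCap (ι : Type) [Fintype ι] (p : ι → unitInterval) (U : Fin 6 → Set (Set ι))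
    (hU : ∀ j, IsUpperSet (U j)) (c : Finset ι) (hpc : ∀ T : Set ι, (∀ j, T ∈ U j) ↔ (↑c : Set ι) ⊆ T) :
    0 ≤ sahiE (bernoulliWeight p) 6 (fun j => ind (U j)) :=
  sahiE_ind_nonneg_of_phiNonneg phiNonneg_six p U hU c hpc

end PrincipalCapBeta

end Summit.CriticalPhenomena.PercolationContinuityZ3.Theorems
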